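import Summits.CriticalPhenomena.Ising3DConformalLimit.Theorems.ReflectionTwinExistsContinuousLimitFoldChain
import HarnessLib

/-!
# The CUBE fold chain: one free-box deficit suffices for doubling

Crux `ExistsContinuousLimit` (item stmt-CriticalPhenomena-4582, routes `ReflectionTwin` / `LogPolarProxy`), line
`free-box-deficit` (lead c7). The landed fold chains (`…FoldChain.lean`, p163440) go through TWO free boxes (the axis box
`A_n = (−h, n+h) × (−h, h)²` and the anisotropic diagonal box `D_n`) because the side mirrors of `A_n` send `ne₀` only to
sup-norm `≈ n`. This file observes that the **fat axis box** (a lattice cube of side `≈ 2n`)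

`C_n = (−h, n+h) × (−n, n) × (−n, n)`, `h = ⌈n/2⌉ = (n+1)/2`,

has ALL SIX mirror images of `ne₀` at sup-norm `≥ 2n` (`(±(n+2h), 0, 0)`, `(n, ±2n, 0)`, `(n, 0, ±2n)`), so the
unconditional face bound (`faceBound`) and Messager–Miracle-Solé give the **cube fold chain**

`g(n) − ⟨σ₀σ_{ne₀}⟩^free_{C_n} ≤ 6·g(2n)`  (`g(n) = G(ne₀)`, `G = criticalTwoPoint 3`),

and hence a SINGLE free-box deficit `⟨σ₀σ_{ne₀}⟩^free_{C_n} ≤ (1 − c)·g(n)` (open) gives item 6150 `TwoPointDoubling`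
with `κ = c/6` (`twoPointDoubling_of_cubeDeficit`) and, with item 4659 by name, the crux
(`existsContinuousLimit_of_cubeDeficit`). No diagonal box, no `G(n,n,0)` comparison is needed.
-/

noncomputable section

namespace Summit.CriticalPhenomena.Ising3DConformalLimit.ReflectionTwinExistsContinuousLimit.FreeBox

open Finset Filter
open scoped BigOperators
open Literature.Probability.LatticeModels
open Summit.CriticalPhenomena.Ising3DConformalLimit.Theses
open Summit.CriticalPhenomena.Ising3DConformalLimit.LogPolarProxyExistsContinuousLimit
  (reflectionTwin_existsContinuousLimit_of_doubling_of_totallyDisconnected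
    existsContinuousLimit_of_doubling_of_totallyDisconnected)
open Classical

/-- `G(n+2h, 0, 0) ≤ G(2n, 0, 0)` when `2h ≥ n` (axis MMS monotonicity). [cite: MessagerMiracleSoleJSP1977, main theorem] -/
theorem cube_far_le {n h : ℕ} (hh : n ≤ 2 * h) :
    criticalTwoPoint 3 ![(n : ℤ) + 2 * h, 0, 0] ≤ criticalTwoPoint 3 ![2 * (n : ℤ), 0, 0] := by
  have := mms_zero_iter (a := 2 * (n : ℤ)) (by positivity) 0 0 (2 * h - n)
  have e : (2 * (n : ℤ)) + ((2 * h - n : ℕ) : ℤ) = (n : ℤ) + 2 * h := by omega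
  rwa [e] at this

/-- `G(n, 2n, 0) ≤ G(2n, 0, 0)` (coordinate MMS monotonicity, then the swap symmetry). [cite: MessagerMiracleSoleJSP1977, main theorem] -/
theorem cube_side_le (n : ℕ) : criticalTwoPoint 3 ![(n : ℤ), 2 * n, 0] ≤ criticalTwoPoint 3 ![2 * (n : ℤ), 0, 0] := by
  have h1 : criticalTwoPoint 3 ![(n : ℤ), 2 * n, 0] ≤ criticalTwoPoint 3 ![0, 2 * (n : ℤ), 0] := by
    have := mms_zero_iter (a := 0) le_rfl (2 * (n : ℤ)) 0 n
    rwa [zero_add] at this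
  have h2 : criticalTwoPoint 3 ![(0 : ℤ), 2 * n, 0] = criticalTwoPoint 3 ![2 * (n : ℤ), 0, 0] := perm_01 _ _ _
  exact h1.trans h2.le

/-- **The six MMS bounds for the cube `C_n`, summed**: every mirror image of `ne₀` in a face of
`C_n = (−h, n+h) × (−n, n)²` has bulk two-point function at most `g(2n)`. [cite: MessagerMiracleSoleJSP1977, main theorem] -/
theorem cube_mmsFaces (n : ℕ) :
    (∑ i : Fin 3, (criticalTwoPoint 3 (Function.update (Pi.single 0 (n : ℤ) : Site 3) i
          (2 * ((fun i : Fin 3 => if i = 0 then (n : ℤ) + (((n + 1) / 2 : ℕ) : ℤ) - 1 else (n : ℤ) - 1) i + 1) -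
            (Pi.single 0 (n : ℤ) : Site 3) i)) +
        criticalTwoPoint 3 (Function.update (Pi.single 0 (n : ℤ) : Site 3) i
          (2 * ((fun i : Fin 3 => if i = 0 then 1 - (((n + 1) / 2 : ℕ) : ℤ) else 1 - (n : ℤ)) i - 1) -
            (Pi.single 0 (n : ℤ) : Site 3) i)))) ≤
      6 * criticalTwoPoint 3 (Pi.single 0 (2 * (n : ℤ))) := by
  set h : ℕ := (n + 1) / 2 with hh_def
  have hh : n ≤ 2 * h := by omega
  have eg2 : criticalTwoPoint 3 (Pi.single 0 (2 * (n : ℤ))) = criticalTwoPoint 3 ![2 * (n : ℤ), 0, 0] :=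
    congrArg (criticalTwoPoint 3) (by funext j; fin_cases j <;> simp)
  have Far : criticalTwoPoint 3 ![(n : ℤ) + 2 * h, 0, 0] ≤ criticalTwoPoint 3 ![2 * (n : ℤ), 0, 0] := cube_far_le hh
  have Side : criticalTwoPoint 3 ![(n : ℤ), 2 * n, 0] ≤ criticalTwoPoint 3 ![2 * (n : ℤ), 0, 0] := cube_side_le n
  set y : Site 3 := Pi.single 0 (n : ℤ) with hy
  have t1 : criticalTwoPoint 3 (Function.update y 0 (2 * (((n : ℤ) + h - 1) + 1) - y 0)) ≤ criticalTwoPoint 3 ![2 * (n : ℤ), 0, 0] := by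
    have e : Function.update y 0 (2 * (((n : ℤ) + h - 1) + 1) - y 0) = ![2 * (((n : ℤ) + h - 1) + 1) - (n : ℤ), 0, 0] := by
      funext j; fin_cases j <;> simp [hy]
    rw [e, show 2 * (((n : ℤ) + h - 1) + 1) - (n : ℤ) = (n : ℤ) + 2 * h by ring]; exact Far
  have t2 : criticalTwoPoint 3 (Function.update y 0 (2 * ((1 - (h : ℤ)) - 1) - y 0)) ≤ criticalTwoPoint 3 ![2 * (n : ℤ), 0, 0] := by
    have e : Function.update y 0 (2 * ((1 - (h : ℤ)) - 1) - y 0) = ![2 * ((1 - (h : ℤ)) - 1) - (n : ℤ), 0, 0] := by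
      funext j; fin_cases j <;> simp [hy]
    rw [e, show 2 * ((1 - (h : ℤ)) - 1) - (n : ℤ) = -((n : ℤ) + 2 * h) by ring, refl_zero]; exact Far
  have t3 : criticalTwoPoint 3 (Function.update y 1 (2 * (((n : ℤ) - 1) + 1) - y 1)) ≤ criticalTwoPoint 3 ![2 * (n : ℤ), 0, 0] := by
    have e : Function.update y 1 (2 * (((n : ℤ) - 1) + 1) - y 1) = ![(n : ℤ), 2 * (((n : ℤ) - 1) + 1) - 0, 0] := by
      funext j; fin_cases j <;> simp [hy]
    rw [e, show 2 * (((n : ℤ) - 1) + 1) - 0 = 2 * (n : ℤ) by ring]; exact Side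
  have t4 : criticalTwoPoint 3 (Function.update y 1 (2 * ((1 - (n : ℤ)) - 1) - y 1)) ≤ criticalTwoPoint 3 ![2 * (n : ℤ), 0, 0] := by
    have e : Function.update y 1 (2 * ((1 - (n : ℤ)) - 1) - y 1) = ![(n : ℤ), 2 * ((1 - (n : ℤ)) - 1) - 0, 0] := by
      funext j; fin_cases j <;> simp [hy]
    rw [e, show 2 * ((1 - (n : ℤ)) - 1) - 0 = -(2 * (n : ℤ)) by ring, refl_one]; exact Side
  have t5 : criticalTwoPoint 3 (Function.update y 2 (2 * (((n : ℤ) - 1) + 1) - y 2)) ≤ criticalTwoPoint 3 ![2 * (n : ℤ), 0, 0] := by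
    have e : Function.update y 2 (2 * (((n : ℤ) - 1) + 1) - y 2) = ![(n : ℤ), 0, 2 * (((n : ℤ) - 1) + 1) - 0] := by
      funext j; fin_cases j <;> simp [hy]
    rw [e, show 2 * (((n : ℤ) - 1) + 1) - 0 = 2 * (n : ℤ) by ring, perm_12]; exact Side
  have t6 : criticalTwoPoint 3 (Function.update y 2 (2 * ((1 - (n : ℤ)) - 1) - y 2)) ≤ criticalTwoPoint 3 ![2 * (n : ℤ), 0, 0] := by
    have e : Function.update y 2 (2 * ((1 - (n : ℤ)) - 1) - y 2) = ![(n : ℤ), 0, 2 * ((1 - (n : ℤ)) - 1) - 0] := by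
      funext j; fin_cases j <;> simp [hy]
    rw [e, show 2 * ((1 - (n : ℤ)) - 1) - 0 = -(2 * (n : ℤ)) by ring, refl_two, perm_12]; exact Side
  have expand : (∑ i : Fin 3, (criticalTwoPoint 3 (Function.update y i
        (2 * ((fun i : Fin 3 => if i = 0 then (n : ℤ) + (h : ℤ) - 1 else (n : ℤ) - 1) i + 1) - y i)) +
      criticalTwoPoint 3 (Function.update y i (2 * ((fun i : Fin 3 => if i = 0 then 1 - (h : ℤ) else 1 - (n : ℤ)) i - 1) - y i)))) =
      (criticalTwoPoint 3 (Function.update y 0 (2 * (((n : ℤ) + h - 1) + 1) - y 0)) + criticalTwoPoint 3 (Function.update y 0 (2 * ((1 - (h : ℤ)) - 1) - y 0))) +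
      (criticalTwoPoint 3 (Function.update y 1 (2 * (((n : ℤ) - 1) + 1) - y 1)) + criticalTwoPoint 3 (Function.update y 1 (2 * ((1 - (n : ℤ)) - 1) - y 1))) +
      (criticalTwoPoint 3 (Function.update y 2 (2 * (((n : ℤ) - 1) + 1) - y 2)) + criticalTwoPoint 3 (Function.update y 2 (2 * ((1 - (n : ℤ)) - 1) - y 2))) := by
    rw [Fin.sum_univ_three]
    simp
  rw [expand, eg2]
  linarith

/-- **CUBE FOLD CHAIN (unconditional).** For `n ≥ 1` and `h = ⌈n/2⌉ = (n+1)/2`: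
`g(n) − ⟨σ₀σ_{ne₀}⟩^free_{C_n} ≤ 6·g(2n)`, where `C_n` is the free box of lattice sites
`{1−h ≤ z₀ ≤ n+h−1, |z₁| ≤ n−1, |z₂| ≤ n−1}` (a lattice cube of side `≈ 2n`; every face mirror sends `ne₀` to sup-norm
`≥ 2n`). [folklore] -/
theorem cubeFoldChain' (n : ℕ) (hn : 1 ≤ n) :
    criticalTwoPoint 3 (Pi.single 0 (n : ℤ)) -
      isingTwoPoint (zdGraph 3)
          (Fintype.piFinset fun i : Fin 3 => Finset.Icc ((fun i : Fin 3 => if i = 0 then 1 - (((n + 1) / 2 : ℕ) : ℤ) else 1 - (n : ℤ)) i)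
            ((fun i : Fin 3 => if i = 0 then (n : ℤ) + (((n + 1) / 2 : ℕ) : ℤ) - 1 else (n : ℤ) - 1) i))
          (criticalBeta 3) 0 .free 0 (Pi.single 0 (n : ℤ)) ≤
      6 * criticalTwoPoint 3 (Pi.single 0 (2 * (n : ℤ))) := by
  have hmem0 : ∀ i : Fin 3, (fun i : Fin 3 => if i = 0 then 1 - (((n + 1) / 2 : ℕ) : ℤ) else 1 - (n : ℤ)) i ≤ (0 : Site 3) i ∧
      (0 : Site 3) i ≤ (fun i : Fin 3 => if i = 0 then (n : ℤ) + (((n + 1) / 2 : ℕ) : ℤ) - 1 else (n : ℤ) - 1) i := by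
    intro i; fin_cases i <;> simp <;> omega
  have hmem1 : ∀ i : Fin 3, (fun i : Fin 3 => if i = 0 then 1 - (((n + 1) / 2 : ℕ) : ℤ) else 1 - (n : ℤ)) i ≤
      (Pi.single 0 (n : ℤ) : Site 3) i ∧
      (Pi.single 0 (n : ℤ) : Site 3) i ≤
        (fun i : Fin 3 => if i = 0 then (n : ℤ) + (((n + 1) / 2 : ℕ) : ℤ) - 1 else (n : ℤ) - 1) i := by
    intro i; fin_cases i <;> simp <;> omega
  have hne : (0 : Site 3) ≠ Pi.single 0 (n : ℤ) := by
    intro h; have := congrFun h 0; simp at this; omega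
  have hF := faceBound _ _ 0 (Pi.single 0 (n : ℤ)) hmem0 hmem1 hne
  simp only [sub_zero] at hF
  exact hF.trans (cube_mmsFaces n)

/-- **TRANSFER: ONE free-box deficit gives item 6150 `TwoPointDoubling` with `κ = c/6`.**
(`c·g(n) ≤ g(n) − freeC(n) ≤ 6·g(2n)`.) [folklore] -/
theorem twoPointDoubling_of_cubeDeficit'
    (hC : ∃ c : ℝ, 0 < c ∧ ∀ n : ℕ, 1 ≤ n →
      isingTwoPoint (zdGraph 3)
          (Fintype.piFinset fun i : Fin 3 => Finset.Icc ((fun i : Fin 3 => if i = 0 then 1 - (((n + 1) / 2 : ℕ) : ℤ) else 1 - (n : ℤ)) i)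
            ((fun i : Fin 3 => if i = 0 then (n : ℤ) + (((n + 1) / 2 : ℕ) : ℤ) - 1 else (n : ℤ) - 1) i))
          (criticalBeta 3) 0 .free 0 (Pi.single 0 (n : ℤ)) ≤
        (1 - c) * criticalTwoPoint 3 (Pi.single 0 (n : ℤ))) :
    MirrorHoelderCompactness.TwoPointDoubling := by
  obtain ⟨c, hc, h⟩ := hC
  refine ⟨c / 6, by positivity, fun n hn => ?_⟩
  have e := cubeFoldChain' n hn
  have d := h n hn
  linarith

/-- **The crux from ONE free-box deficit and item 4659 (by name)** — `ReflectionTwin` copy. [folklore] -/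
theorem existsContinuousLimit_of_cubeDeficit
    (hC : ∃ c : ℝ, 0 < c ∧ ∀ n : ℕ, 1 ≤ n →
      isingTwoPoint (zdGraph 3)
          (Fintype.piFinset fun i : Fin 3 => Finset.Icc ((fun i : Fin 3 => if i = 0 then 1 - (((n + 1) / 2 : ℕ) : ℤ) else 1 - (n : ℤ)) i)
            ((fun i : Fin 3 => if i = 0 then (n : ℤ) + (((n + 1) / 2 : ℕ) : ℤ) - 1 else (n : ℤ) - 1) i))
          (criticalBeta 3) 0 .free 0 (Pi.single 0 (n : ℤ)) ≤
        (1 - c) * criticalTwoPoint 3 (Pi.single 0 (n : ℤ)))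
    (h4659 : ClusterRigidity.ClusterSetTotallyDisconnected) :
    ReflectionTwin.ExistsContinuousLimit :=
  reflectionTwin_existsContinuousLimit_of_doubling_of_totallyDisconnected (twoPointDoubling_of_cubeDeficit' hC) h4659

/-- **The crux from ONE free-box deficit and item 4659 (by name)** — `LogPolarProxy` copy (same term). [folklore] -/
theorem logPolarProxy_existsContinuousLimit_of_cubeDeficit
    (hC : ∃ c : ℝ, 0 < c ∧ ∀ n : ℕ, 1 ≤ n →
      isingTwoPoint (zdGraph 3)
          (Fintype.piFinset fun i : Fin 3 => Finset.Icc ((fun i : Fin 3 => if i = 0 then 1 - (((n + 1) / 2 : ℕ) : ℤ) else 1 - (n : ℤ)) i)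
            ((fun i : Fin 3 => if i = 0 then (n : ℤ) + (((n + 1) / 2 : ℕ) : ℤ) - 1 else (n : ℤ) - 1) i))
          (criticalBeta 3) 0 .free 0 (Pi.single 0 (n : ℤ)) ≤
        (1 - c) * criticalTwoPoint 3 (Pi.single 0 (n : ℤ)))
    (h4659 : ClusterRigidity.ClusterSetTotallyDisconnected) :
    LogPolarProxy.ExistsContinuousLimit :=
  existsContinuousLimit_of_doubling_of_totallyDisconnected (twoPointDoubling_of_cubeDeficit' hC) h4659

/-! ## Registered sub-goals (verbatim headers) -/

/-- **Registered sub-goal `cubeFoldChain`** (verbatim signature): the cube fold chain. [folklore] -/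
theorem cubeFoldChain : ∀ n : ℕ, 1 ≤ n → Literature.Probability.LatticeModels.criticalTwoPoint 3 (Pi.single 0 (n : ℤ)) - Literature.Probability.LatticeModels.isingTwoPoint (Literature.Probability.LatticeModels.zdGraph 3) (Fintype.piFinset fun i : Fin 3 => Finset.Icc ((fun i : Fin 3 => if i = 0 then 1 - (((n + 1) / 2 : ℕ) : ℤ) else 1 - (n : ℤ)) i) ((fun i : Fin 3 => if i = 0 then (n : ℤ) + (((n + 1) / 2 : ℕ) : ℤ) - 1 else (n : ℤ) - 1) i)) (Literature.Probability.LatticeModels.criticalBeta 3) 0 .free 0 (Pi.single 0 (n : ℤ)) ≤ 6 * Literature.Probability.LatticeModels.criticalTwoPoint 3 (Pi.single 0 (2 * (n : ℤ))) :=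
  cubeFoldChain'

/-- **Registered sub-goal `twoPointDoubling_of_cubeDeficit`** (verbatim signature): one cube deficit gives item 6150. [folklore] -/
theorem twoPointDoubling_of_cubeDeficit : (∃ c : ℝ, 0 < c ∧ ∀ n : ℕ, 1 ≤ n → Literature.Probability.LatticeModels.isingTwoPoint (Literature.Probability.LatticeModels.zdGraph 3) (Fintype.piFinset fun i : Fin 3 => Finset.Icc ((fun i : Fin 3 => if i = 0 then 1 - (((n + 1) / 2 : ℕ) : ℤ) else 1 - (n : ℤ)) i) ((fun i : Fin 3 => if i = 0 then (n : ℤ) + (((n + 1) / 2 : ℕ) : ℤ) - 1 else (n : ℤ) - 1) i)) (Literature.Probability.LatticeModels.criticalBeta 3) 0 .free 0 (Pi.single 0 (n : ℤ)) ≤ (1 - c) * Literature.Probability.LatticeModels.criticalTwoPoint 3 (Pi.single 0 (n : ℤ))) → Summit.CriticalPhenomena.Ising3DConformalLimit.Theses.MirrorHoelderCompactness.TwoPointDoubling :=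
  twoPointDoubling_of_cubeDeficit'

end Summit.CriticalPhenomena.Ising3DConformalLimit.ReflectionTwinExistsContinuousLimit.FreeBox

end
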